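import Literature.AlgebraicGeometry.Motives.FaltingsECEndCoreOpenSubgroupProofs
import Literature.NumberTheory.GaloisRepresentations.InducedGaloisRep
import HarnessLib

/-!
# Faltings 1983, Satz 4 for an elliptic curve: the core fact descends along finite extensions
# of the base field (Serre 1968, IV.2.2: "replacing `K` by a finite extension")

`Proofs` file (theorems only, no definitions, no named facts), topic `AlgebraicGeometry/Motives`,
sibling of `FaltingsECEndCoreOpenSubgroupProofs`.

The named fact `exists_eq_smul_one_of_equivariant_of_not_hasRationalCM W ℓ` (`FaltingsECEndCore`)
asks, for an elliptic curve `E` over a number field `K` such that `V_ℓ E` has no `Γ_K`-stable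
`ℚ_ℓ`-line, that every `Γ_K`-equivariant endomorphism of `V_ℓ E` be a scalar (the `ℓ`-adic image
is not in a non-split Cartan subgroup, Serre 1968, IV.2.2).  Serre's proof begins by replacing
`K` by a finite extension.  This file justifies that step in the tree's language:

* `exists_eq_smul_one_of_equivariant_of_extension` — **the conclusion for `E/K` follows from the
  conclusion for `E_L / L`**, `L/K` any finite extension of number fields: transport `V_ℓ E ≅ V_ℓ E_L`
  compatibly with `res : Γ_L → Γ_K` (`WeierstrassCurve.exists_rationalTateModule_equiv_baseChange`);
  a non-scalar equivariant `G` transports to one for `Γ_L`; and a `Γ_L`-stable line of `V_ℓ E_L`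
  pulls back to a line of `V_ℓ E` stable under the *open* subgroup `res(Γ_L)`
  (`isOpen_range_absGaloisRestrict`), which contains an element `σ` with `ρ_ℓ(σ)` non-scalar
  (`exists_mem_forall_ne_smul_one_of_isOpen`, the tree's Lemma "no open subgroup acts by
  scalars"); since `ρ_ℓ(σ) = p + qG` with `q ≠ 0` (`exists_eq_smul_one_add_smul_of_commute`), the
  line is `G`-stable, hence stable under every `ρ_ℓ(g) = p' + q'G` — a `Γ_K`-stable line,
  contradiction.
* `exists_eq_smul_one_of_equivariant_of_not_hasRationalCM_of_extension` — the named core fact for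
  `W` follows from the "no stable line ⇒ scalar commutant" statement for `E_L` (the form in which
  all the tree's cases are proved: real place, multiplicative place, `ord_v(j) < 0`, potential CM,
  ordinary place above `ℓ`).

## References

* [SerreAbelianLadic1968] J.-P. Serre, *Abelian ℓ-adic representations and elliptic curves*
  (1968), Ch. IV §2.2 (proof of the Theorem: reduction to an open subgroup).
* [Faltings1983Endlichkeit] G. Faltings, Invent. Math. 73 (1983), §5 Satz 4.
-/

noncomputable section

open scoped TensorProduct

universe u

namespace Literature.AlgebraicGeometry.Motives

open WeierstrassCurve Module Literature.NumberTheory.EllipticCurves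
  Literature.NumberTheory.GaloisRepresentations Field

variable {K : Type u} [Field K] (W : WeierstrassCurve K) (ℓ : ℕ) [hℓ : Fact ℓ.Prime]

/-- **The scalar-commutant statement descends along finite extensions.**  Let `E/K` be an
elliptic curve over a number field, `ℓ` a prime and `L/K` a finite extension (a number field with
`Algebra K L`).  Suppose that for `E_L` every `Γ_L`-equivariant endomorphism of `V_ℓ E_L` is a
scalar as soon as `V_ℓ E_L` has no `Γ_L`-stable line.  Then the same holds for `E/K`.
[Serre 1968, IV.2.2 (proof)] [cite: SerreAbelianLadic1968, IV.2.2] -/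
theorem exists_eq_smul_one_of_equivariant_of_extension [NumberField K] [W.IsElliptic]
    (L : Type u) [Field L] [NumberField L] [Algebra K L]
    (hL : (∀ M : Submodule ℚ_[ℓ] ((W.baseChange L).rationalTateModule ℓ),
        (∀ γ : Field.absoluteGaloisGroup L, ∀ v ∈ M,
          rationalGaloisRepTate (W.baseChange L) ℓ γ v ∈ M) → Module.finrank ℚ_[ℓ] M ≠ 1) →
      ∀ G' : Module.End ℚ_[ℓ] ((W.baseChange L).rationalTateModule ℓ),
        (∀ (γ : Field.absoluteGaloisGroup L) (v : (W.baseChange L).rationalTateModule ℓ),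
          G' (rationalGaloisRepTate (W.baseChange L) ℓ γ v) =
            rationalGaloisRepTate (W.baseChange L) ℓ γ (G' v)) →
        ∃ c : ℚ_[ℓ], G' = c • 1)
    (hnl : ∀ M : Submodule ℚ_[ℓ] (W.rationalTateModule ℓ),
      (∀ σ : Field.absoluteGaloisGroup K, ∀ v ∈ M, rationalGaloisRepTate W ℓ σ v ∈ M) →
        Module.finrank ℚ_[ℓ] M ≠ 1)
    (G : Module.End ℚ_[ℓ] (W.rationalTateModule ℓ))
    (hG : ∀ (σ : Field.absoluteGaloisGroup K) (v : W.rationalTateModule ℓ),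
      G (rationalGaloisRepTate W ℓ σ v) = rationalGaloisRepTate W ℓ σ (G v)) :
    ∃ c : ℚ_[ℓ], G = c • 1 := by
  by_contra hns
  have hℓK : (ℓ : K) ≠ 0 := Nat.cast_ne_zero.mpr hℓ.out.ne_zero
  have h2 := finrank_rationalTateModule_eq_two_holds W ℓ hℓK
  set ρ := rationalGaloisRepTate W ℓ with hρ
  set ρ' := rationalGaloisRepTate (W.baseChange L) ℓ with hρ'
  have hs : ∀ σ, G * ρ σ = ρ σ * G := fun σ ↦ LinearMap.ext fun v ↦ hG σ v
  -- transport `V_ℓ E ≅ V_ℓ E_L` along `res : Γ_L → Γ_K`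
  obtain ⟨E, hE⟩ := W.exists_rationalTateModule_equiv_baseChange L ℓ
  set G' : Module.End ℚ_[ℓ] ((W.baseChange L).rationalTateModule ℓ) :=
    E.toLinearMap ∘ₗ G ∘ₗ E.symm.toLinearMap with hG'def
  have hG'apply : ∀ y, G' y = E (G (E.symm y)) := fun y ↦ rfl
  have hG' : ∀ (γ : Field.absoluteGaloisGroup L) (y : (W.baseChange L).rationalTateModule ℓ),
      G' (ρ' γ y) = ρ' γ (G' y) := by
    intro γ y
    obtain ⟨x, rfl⟩ := E.surjective y
    rw [hG'apply, hG'apply, E.symm_apply_apply, ← hE γ x, E.symm_apply_apply, hG, hE]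
  -- `G'` is not a scalar, so `V_ℓ E_L` has a `Γ_L`-stable line
  have hG'ns : ¬ ∃ c : ℚ_[ℓ], G' = c • 1 := by
    rintro ⟨c, hc⟩
    apply hns
    refine ⟨c, LinearMap.ext fun x ↦ ?_⟩
    have := congrArg (fun T : Module.End ℚ_[ℓ] ((W.baseChange L).rationalTateModule ℓ) ↦
      E.symm (T (E x))) hc
    simpa [hG'apply] using this
  have hline : ∃ M : Submodule ℚ_[ℓ] ((W.baseChange L).rationalTateModule ℓ),
      (∀ γ : Field.absoluteGaloisGroup L, ∀ v ∈ M, ρ' γ v ∈ M) ∧ Module.finrank ℚ_[ℓ] M = 1 := by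
    by_contra hno
    push Not at hno
    exact hG'ns (hL (fun M hM h1 ↦ hno M hM h1) G' hG')
  obtain ⟨M, hMstab, hM1⟩ := hline
  -- its pull-back is a line of `V_ℓ E` stable under `res(Γ_L)`
  set M₀ : Submodule ℚ_[ℓ] (W.rationalTateModule ℓ) := M.comap E.toLinearMap with hM₀
  have hM₀1 : Module.finrank ℚ_[ℓ] M₀ = 1 := by
    rw [hM₀, ← hM1]
    exact (Submodule.comap_equiv_eq_map_symm E M ▸ (LinearEquiv.finrank_map_eq E.symm M))
  have hM₀stab : ∀ (γ : Field.absoluteGaloisGroup L), ∀ v ∈ M₀,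
      ρ (absGaloisRestrict K L γ) v ∈ M₀ := by
    intro γ v hv
    rw [hM₀, Submodule.mem_comap] at hv ⊢
    change E (ρ (absGaloisRestrict K L γ) v) ∈ M
    rw [hE]
    exact hMstab γ _ hv
  -- an element of the open subgroup `res(Γ_L)` acting by a non-scalar
  obtain ⟨σ, ⟨γ, rfl⟩, hσ⟩ := exists_mem_forall_ne_smul_one_of_isOpen W ℓ (absGaloisRestrict K L).range
    (isOpen_range_absGaloisRestrict K L)
  -- `ρ σ = p + q G` with `q ≠ 0`, so `M₀` is `G`-stable ...
  obtain ⟨p, q, hpq⟩ := exists_eq_smul_one_add_smul_of_commute h2 hns (hs (absGaloisRestrict K L γ)).symm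
  have hq : q ≠ 0 := by
    rintro rfl
    rw [zero_smul, add_zero] at hpq
    exact hσ p hpq
  have hGstab : ∀ v ∈ M₀, G v ∈ M₀ := by
    intro v hv
    have h1 := hM₀stab γ v hv
    rw [hpq, LinearMap.add_apply, LinearMap.smul_apply, LinearMap.smul_apply,
      Module.End.one_apply] at h1
    have h2' : q • G v ∈ M₀ := by
      have := Submodule.sub_mem _ h1 (Submodule.smul_mem _ p hv)
      rwa [add_sub_cancel_left] at this
    have := Submodule.smul_mem _ q⁻¹ h2'
    rwa [smul_smul, inv_mul_cancel₀ hq, one_smul] at this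
  -- ... hence stable under every `ρ g = p' + q' G`: a `Γ_K`-stable line, contradiction
  refine hnl M₀ (fun g v hv ↦ ?_) hM₀1
  obtain ⟨p', q', hpq'⟩ := exists_eq_smul_one_add_smul_of_commute h2 hns (hs g).symm
  rw [hpq', LinearMap.add_apply, LinearMap.smul_apply, LinearMap.smul_apply, Module.End.one_apply]
  exact Submodule.add_mem _ (Submodule.smul_mem _ _ hv) (Submodule.smul_mem _ _ (hGstab v hv))

/-- **The named core fact descends along finite extensions**: for a Weierstrass curve `W` over
a field `K`, a prime `ℓ` and a finite extension `L/K` of number fields, if the scalar-commutant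
statement holds for `W.baseChange L` (in the hypothesis form of the named fact, for `E_L`
elliptic), then `exists_eq_smul_one_of_equivariant_of_not_hasRationalCM W ℓ` holds — the
hypothesis `End_K(E) = ℤ` being unused. [cite: SerreAbelianLadic1968, IV.2.2]
[cite: Faltings1983Endlichkeit, §5 Satz 4] -/
theorem exists_eq_smul_one_of_equivariant_of_not_hasRationalCM_of_extension
    (L : Type u) [Field L] [NumberField L] [Algebra K L]
    (hL : ∀ [NumberField K] [W.IsElliptic],
      (∀ M : Submodule ℚ_[ℓ] ((W.baseChange L).rationalTateModule ℓ),
        (∀ γ : Field.absoluteGaloisGroup L, ∀ v ∈ M,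
          rationalGaloisRepTate (W.baseChange L) ℓ γ v ∈ M) → Module.finrank ℚ_[ℓ] M ≠ 1) →
      ∀ G' : Module.End ℚ_[ℓ] ((W.baseChange L).rationalTateModule ℓ),
        (∀ (γ : Field.absoluteGaloisGroup L) (v : (W.baseChange L).rationalTateModule ℓ),
          G' (rationalGaloisRepTate (W.baseChange L) ℓ γ v) =
            rationalGaloisRepTate (W.baseChange L) ℓ γ (G' v)) →
        ∃ c : ℚ_[ℓ], G' = c • 1) :
    exists_eq_smul_one_of_equivariant_of_not_hasRationalCM W ℓ := by
  intro _ _ _ hnl G hG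
  exact exists_eq_smul_one_of_equivariant_of_extension W ℓ L hL hnl G hG

end Literature.AlgebraicGeometry.Motives

end
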